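import Literature.Computability.AlgebraicComplexity.LaserComponentTools
import Literature.Computability.AlgebraicComplexity.LaserMethodBigCW
import HarnessLib

/-!
# The level-1 components of `CW_q` as zero-outs, their matrix shapes and Le Gall values — proved

Topic `Literature/Computability/AlgebraicComplexity`.  Coppersmith–Winograd 1990, §7 (eq. (10)):
`CW_q = ∑_{i=1}^q (x₀yᵢzᵢ + xᵢy₀zᵢ + xᵢyᵢz₀) + x₀y₀z_{q+1} + x₀y_{q+1}z₀ + x_{q+1}y₀z₀`, partitioned by
the level `0 ↦ 0, i ↦ 1, q+1 ↦ 2` of each index into the six components `T_{011} ≅ ⟨1,q,1⟩`-type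
matrix products (`x₀yᵢzᵢ`, `xᵢy₀zᵢ`, `xᵢyᵢz₀`) and the three scalar corner terms
`T_{002}, T_{020}, T_{200} ≅ ⟨1,1,1⟩` (BCS 1997, §15.8; VXXZ 2024, §3.6).  This file records this
decomposition in the coordinates of the tree's laser method (`partSubtensor` with the label map
`cwLevel₃ : Fin (q+2) → Fin 3` of `LaserMethodBigCW.lean`) and PROVES:

* the labels `cwLevel₃ : Fin (q+2) → Fin 3` and the support `cwSupport₃ = {(i,j,l) | i+j+l = 2}` are
  those of `LaserMethodBigCW.lean` (`cwLevel₃_mem_support`); here: their values on `x₀, xᵢ, x_{q+1}`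
  and the tightness data `cwTight`, `cwTightγ` (`r = 1`, bound `2`);
* `cwComp q i j l` — the component `T_{ijl}` (a zero-out of `CW_q`, an abbreviation);
  `tensorRestrictsTo_cwComp011` (`T_{011} ≥ ⟨1,q,1⟩`), `…101` (`≥ ⟨1,1,q⟩`), `…110` (`≥ ⟨q,1,1⟩`),
  `…002`, `…020`, `…200` (`≥ ⟨1,1,1⟩`);
* the Le Gall values `hasLaserValue_symm3_cwComp…`: `V_ρ(T_{011}) ≥ q^{ρ/3}` etc., `V_ρ(T_{002}) ≥ 1`.

Everything is proved; definitions are abbreviations; no named facts.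

## References

* D. Coppersmith, S. Winograd, *Matrix multiplication via arithmetic progressions*, J. Symbolic
  Comput. 9 (1990), §7 eq. (10), §8. [CoppersmithWinograd1990]
* P. Bürgisser, M. Clausen, M. A. Shokrollahi, *Algebraic Complexity Theory* (1997), §15.8.
  [BurgisserClausenShokrollahi1997]
* V. Vassilevska Williams, Y. Xu, Z. Xu, R. Zhou, SODA 2024, arXiv:2307.07970, §3.6–3.7.
  [VassilevskaWilliamsXuXuZhou2024]
-/

noncomputable section

open scoped BigOperators
open Finset

namespace Literature.Computability.AlgebraicComplexity

open Literature.Barriers.MatrixMultiplication (bigCwTensor bigCwTensor_apply bigCwTensor_corner)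

universe u

/-! ## Levels as labels, the support, tightness -/

section Labels

variable {q : ℕ}

/-- `x₀` has level `0`. [folklore] -/
@[simp] theorem cwLevel₃_zero : cwLevel₃ (0 : Fin (q + 2)) = 0 := by
  ext; simp [cwLevel₃]

/-- Middle indices have level `1`. [folklore] -/
@[simp] theorem cwLevel₃_mid (i : Fin q) : cwLevel₃ (cwMid i) = 1 := by
  ext; simp [cwLevel₃]

/-- `x_{q+1}` has level `2`. [folklore] -/
@[simp] theorem cwLevel₃_last : cwLevel₃ (Fin.last (q + 1)) = 2 := by
  ext; simp [cwLevel₃]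

/-- Tightness vectors for the first two coordinates: the level itself. [folklore] -/
def cwTight (i : Fin 3) : Fin 1 → ℤ := fun _ => (i : ℕ)

/-- Tightness vector for the third coordinate: level minus `2`. [folklore] -/
def cwTightγ (l : Fin 3) : Fin 1 → ℤ := fun _ => (l : ℕ) - 2

/-- `cwTight` is injective. [folklore] -/
theorem cwTight_injective : Function.Injective (cwTight) := fun i j h => by
  have := congrFun h 0
  simp only [cwTight, Nat.cast_inj] at this
  exact Fin.ext this

/-- `cwTightγ` is injective. [folklore] -/
theorem cwTightγ_injective : Function.Injective (cwTightγ) := fun i j h => by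
  have := congrFun h 0
  simp only [cwTightγ, sub_left_inj, Nat.cast_inj] at this
  exact Fin.ext this

/-- `|cwTight i| ≤ 2`. [folklore] -/
theorem cwTight_bound (i : Fin 3) (k : Fin 1) : |cwTight i k| ≤ (2 : ℕ) := by
  simp only [cwTight]
  have := i.isLt
  rw [abs_of_nonneg (by positivity)]
  exact_mod_cast (by omega : (i : ℕ) ≤ 2)

/-- The tightness relation on the level-1 support. [folklore] -/
theorem cwTight_sum (s : Fin 3 × Fin 3 × Fin 3) (hs : s ∈ cwSupport₃) (k : Fin 1) :
    cwTight s.1 k + cwTight s.2.1 k + cwTightγ s.2.2 k = 0 := by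
  rw [mem_cwSupport₃] at hs
  simp only [cwTight, cwTightγ]
  omega

end Labels

/-! ## The components and their shapes -/

section Components

variable (K : Type u) [Field K] (q : ℕ)

/-- **The level-1 component `T_{ijl}` of `CW_q`** (the zero-out to levels `i, j, l`).
[cite: VassilevskaWilliamsXuXuZhou2024, §3.7] -/
abbrev cwComp (i j l : Fin 3) : Fin (q + 2) → Fin (q + 2) → Fin (q + 2) → K :=
  partSubtensor cwLevel₃ cwLevel₃ cwLevel₃ (bigCwTensor K q) {i} {j} {l}

/-- **`T_{011} = ∑ᵢ x₀yᵢzᵢ ≥ ⟨1,q,1⟩`.** [cite: CoppersmithWinograd1990, §7 eq. (10)] -/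
theorem tensorRestrictsTo_cwComp011 : TensorRestrictsTo (cwComp K q 0 1 1) (matMulTensor K 1 q 1) := by
  refine tensorRestrictsTo_matMulTensor_mid _ 0 cwMid cwMid fun i j => ?_
  simp only [partSubtensor_apply, Finset.mem_singleton, cwLevel₃_zero, cwLevel₃_mid, true_and, if_true]
  exact bigCwTensor_zero_mid_mid K q i j

/-- **`T_{101} = ∑ᵢ xᵢy₀zᵢ ≥ ⟨1,1,q⟩`.** [cite: CoppersmithWinograd1990, §7 eq. (10)] -/
theorem tensorRestrictsTo_cwComp101 : TensorRestrictsTo (cwComp K q 1 0 1) (matMulTensor K 1 1 q) := by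
  refine tensorRestrictsTo_matMulTensor_right _ cwMid 0 cwMid fun i j => ?_
  simp only [partSubtensor_apply, Finset.mem_singleton, cwLevel₃_zero, cwLevel₃_mid, true_and, if_true]
  exact bigCwTensor_mid_zero_mid K q i j

/-- **`T_{110} = ∑ᵢ xᵢyᵢz₀ ≥ ⟨q,1,1⟩`.** [cite: CoppersmithWinograd1990, §7 eq. (10)] -/
theorem tensorRestrictsTo_cwComp110 : TensorRestrictsTo (cwComp K q 1 1 0) (matMulTensor K q 1 1) := by
  refine tensorRestrictsTo_matMulTensor_left _ cwMid cwMid 0 fun i j => ?_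
  simp only [partSubtensor_apply, Finset.mem_singleton, cwLevel₃_zero, cwLevel₃_mid, and_true, if_true]
  exact bigCwTensor_mid_mid_zero K q i j

/-- **`T_{002} = x₀y₀z_{q+1} ≥ ⟨1,1,1⟩`.** [cite: CoppersmithWinograd1990, §7 eq. (10)] -/
theorem tensorRestrictsTo_cwComp002 : TensorRestrictsTo (cwComp K q 0 0 2) (matMulTensor K 1 1 1) := by
  refine tensorRestrictsTo_matMulTensor_mid _ 0 (fun _ => 0) (fun _ => Fin.last (q + 1)) fun i j => ?_
  have hij : i = j := Subsingleton.elim _ _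
  simp only [partSubtensor_apply, Finset.mem_singleton, cwLevel₃_zero, cwLevel₃_last, true_and, if_true,
    hij]
  exact bigCwTensor_corner K q

/-- **`T_{020} = x₀y_{q+1}z₀ ≥ ⟨1,1,1⟩`.** [cite: CoppersmithWinograd1990, §7 eq. (10)] -/
theorem tensorRestrictsTo_cwComp020 : TensorRestrictsTo (cwComp K q 0 2 0) (matMulTensor K 1 1 1) := by
  refine tensorRestrictsTo_matMulTensor_mid _ 0 (fun _ => Fin.last (q + 1)) (fun _ => 0) fun i j => ?_
  have hij : i = j := Subsingleton.elim _ _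
  simp only [partSubtensor_apply, Finset.mem_singleton, cwLevel₃_zero, cwLevel₃_last, and_true, if_true, hij]
  exact bigCwTensor_zero_last_zero K q

/-- **`T_{200} = x_{q+1}y₀z₀ ≥ ⟨1,1,1⟩`.** [cite: CoppersmithWinograd1990, §7 eq. (10)] -/
theorem tensorRestrictsTo_cwComp200 : TensorRestrictsTo (cwComp K q 2 0 0) (matMulTensor K 1 1 1) := by
  refine tensorRestrictsTo_matMulTensor_mid _ (Fin.last (q + 1)) (fun _ => 0) (fun _ => 0) fun i j => ?_
  have hij : i = j := Subsingleton.elim _ _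
  simp only [partSubtensor_apply, Finset.mem_singleton, cwLevel₃_zero, cwLevel₃_last, and_true, if_true, hij]
  exact bigCwTensor_last_zero_zero K q

/-! ### Le Gall values of the components -/

/-- `V_ρ(T_{011}) ≥ q^{ρ/3}` (Le Gall's value). [cite: CoppersmithWinograd1990, §8] -/
theorem hasLaserValue_symm3_cwComp011 (ρ : ℝ) :
    HasLaserValue ρ (symm3 (cwComp K q 0 1 1)) (((q : ℝ) ^ (ρ / 3)) ^ 3) := by
  simpa using hasLaserValue_symm3_of_restrictsTo_matMulTensor ρ (tensorRestrictsTo_cwComp011 K q)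

/-- `V_ρ(T_{101}) ≥ q^{ρ/3}`. [cite: CoppersmithWinograd1990, §8] -/
theorem hasLaserValue_symm3_cwComp101 (ρ : ℝ) :
    HasLaserValue ρ (symm3 (cwComp K q 1 0 1)) (((q : ℝ) ^ (ρ / 3)) ^ 3) := by
  simpa using hasLaserValue_symm3_of_restrictsTo_matMulTensor ρ (tensorRestrictsTo_cwComp101 K q)

/-- `V_ρ(T_{110}) ≥ q^{ρ/3}`. [cite: CoppersmithWinograd1990, §8] -/
theorem hasLaserValue_symm3_cwComp110 (ρ : ℝ) :
    HasLaserValue ρ (symm3 (cwComp K q 1 1 0)) (((q : ℝ) ^ (ρ / 3)) ^ 3) := by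
  simpa using hasLaserValue_symm3_of_restrictsTo_matMulTensor ρ (tensorRestrictsTo_cwComp110 K q)

/-- `V_ρ(T_{002}) ≥ 1`. [cite: CoppersmithWinograd1990, §8] -/
theorem hasLaserValue_symm3_cwComp002 (ρ : ℝ) : HasLaserValue ρ (symm3 (cwComp K q 0 0 2)) 1 := by
  simpa using hasLaserValue_symm3_of_restrictsTo_matMulTensor ρ (tensorRestrictsTo_cwComp002 K q)

/-- `V_ρ(T_{020}) ≥ 1`. [cite: CoppersmithWinograd1990, §8] -/
theorem hasLaserValue_symm3_cwComp020 (ρ : ℝ) : HasLaserValue ρ (symm3 (cwComp K q 0 2 0)) 1 := by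
  simpa using hasLaserValue_symm3_of_restrictsTo_matMulTensor ρ (tensorRestrictsTo_cwComp020 K q)

/-- `V_ρ(T_{200}) ≥ 1`. [cite: CoppersmithWinograd1990, §8] -/
theorem hasLaserValue_symm3_cwComp200 (ρ : ℝ) : HasLaserValue ρ (symm3 (cwComp K q 2 0 0)) 1 := by
  simpa using hasLaserValue_symm3_of_restrictsTo_matMulTensor ρ (tensorRestrictsTo_cwComp200 K q)

end Components

end Literature.Computability.AlgebraicComplexity
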